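import Mathlib

/-!
# Crux `HodgeAbelianVarieties` (stmt-HodgeConjecture-1333), line `cm-pivot-andre` — André with CM targets, module L1: the field data

Pure algebra behind the lead's construction of André's decomposition (`work/andre/PLAN.md` §2, §4). Input: the
`N = 2 dim A` distinct, non-real eigenvalues `μ` of a CM endomorphism on `H¹(A(ℂ); ℂ)`, roots of a RATIONAL polynomial
(the characteristic polynomial of the rational representation). Output (`exists_andreFieldData`): the degree `n` and the
integer coefficients `b` of the minimal polynomial of an integral primitive element `θ` of `E = ℚ(μ₀, …, μ_{N-1}) ⊂ ℂ`, its
`n` complex conjugates `ρ` (pairwise distinct, all non-real, with integer power sums), for each conjugate `ρ_s = σ_s(θ)`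
the permutation `e_s` of the eigenvalues induced by the embedding `σ_s` (`σ_s(μ_j) = μ_{e_s j}`), and the rational
coefficients `c j k l` of the Lagrange idempotents of the `μ_j` written in the power basis of `θ`, with the KEY IDENTITY
`Σ_{k,l} c j k l · μ_λ^k · ρ_s^l = [λ = e_s j]` — the eigenvalues, on the lines of `H¹((A ⊗ O_E)(ℂ); ℂ)`, of the
endomorphisms `u_j = Σ c_{jkl} θ^l ψ^k` that cut out André's targets. No abelian varieties here.
-/

set_option linter.dupNamespace false

noncomputable section

namespace Summit.HodgeConjecture.HodgeConjecture.Theorems.HodgeAbelianVarieties.CMPivotAndre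

open Polynomial

/-- **André field data.** Let `μ : Fin N → ℂ` (`0 < N`) be pairwise distinct NON-REAL complex numbers which are
exactly the roots of a rational polynomial (`m.map = ∏ (X - μ i)`). Then there are `n ≥ 1`, integers
`b : Fin n → ℤ`, pairwise distinct non-real `ρ : Fin n → ℂ`, permutations `e s` of `Fin N` and rationals
`c j k l` such that: every `ρ s` is a root of `X^n + Σ b_j X^j`; every power sum `Σ_s ρ_s^i` is an integer; and
`Σ_k Σ_l c j k l · (μ λ)^k · (ρ s)^l = 1` if `λ = e s j` and `0` otherwise. (Here `E = ℚ(μ)`, `θ ∈ E` an integral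
primitive element with minimal polynomial `X^n + Σ b_j X^j`, `ρ_s = σ_s(θ)` over the `n` embeddings `σ_s : E → ℂ`,
`σ_s(μ_j) = μ_{e_s j}`, and `Σ_l c j k l θ^l` is the `k`-th coefficient of the Lagrange idempotent of `μ_j`.)
[cite: Andre1992HodgeCM, Théorème] [cite: Deligne1982HodgeCycles, §4 (4.3)–(4.4)] -/
theorem exists_andreFieldData : ∀ {N : ℕ} (μ : Fin N → ℂ), 0 < N → Function.Injective μ → (∀ i, (μ i).im ≠ 0) → (∃ m : Polynomial ℚ, m.map (algebraMap ℚ ℂ) = ∏ i, (Polynomial.X - Polynomial.C (μ i))) → ∃ (n : ℕ) (b : Fin n → ℤ) (ρ : Fin n → ℂ) (e : Fin n → Equiv.Perm (Fin N)) (c : Fin N → Fin N → Fin n → ℚ), 0 < n ∧ Function.Injective ρ ∧ (∀ s, (ρ s).im ≠ 0) ∧ (∀ s, ρ s ^ n + ∑ j, (b j : ℂ) * ρ s ^ (j : ℕ) = 0) ∧ (∀ i : ℕ, ∃ z : ℤ, ∑ s, ρ s ^ i = (z : ℂ)) ∧ (∀ s j l', ∑ k, ∑ l, (c j k l : ℂ)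 * μ l' ^ (k : ℕ) * ρ s ^ (l : ℕ) = if l' = e s j then 1 else 0) := by
  intro N μ hN hμ hμim hm
  classical
  obtain ⟨m, hm⟩ := hm
  -- `∏ (X - μ i)` is monic, so `m ≠ 0` and each `μ i` is algebraic, hence integral, over `ℚ`
  have hprod_monic : (∏ i, (X - C (μ i))).Monic := monic_prod_of_monic _ _ fun i _ => monic_X_sub_C (μ i)
  have hm0 : m ≠ 0 := by
    intro h
    rw [h, Polynomial.map_zero] at hm
    exact hprod_monic.ne_zero hm.symm
  have heval_prod : ∀ x : ℂ, (∏ i, (X - C (μ i))).eval x = ∏ i, (x - μ i) := fun x => by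
    rw [eval_prod]
    simp only [eval_sub, eval_X, eval_C]
  have hroot_iff : ∀ x : ℂ, aeval x m = 0 ↔ ∃ i, x = μ i := fun x => by
    rw [aeval_def, ← eval_map, hm, heval_prod, Finset.prod_eq_zero_iff]
    simp only [Finset.mem_univ, true_and, sub_eq_zero]
  have hμint : ∀ i, IsIntegral ℚ (μ i) := fun i =>
    (isAlgebraic_iff_isIntegral.mp ⟨m, hm0, (hroot_iff (μ i)).mpr ⟨i, rfl⟩⟩)
  -- the field `E = ℚ(μ)` inside `ℂ`
  set E : IntermediateField ℚ ℂ := IntermediateField.adjoin ℚ (Set.range μ) with hE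
  haveI : FiniteDimensional ℚ E :=
    IntermediateField.finiteDimensional_adjoin fun x hx => by
      obtain ⟨i, rfl⟩ := hx
      exact hμint i
  have hμmem : ∀ j, μ j ∈ E := fun j => IntermediateField.subset_adjoin ℚ _ ⟨j, rfl⟩
  set β : Fin N → E := fun j => ⟨μ j, hμmem j⟩ with hβ
  have hβval : ∀ j, (β j : ℂ) = μ j := fun j => rfl
  have hβinj : Function.Injective β := fun j j' h => hμ (congrArg Subtype.val h)
  -- a primitive element, scaled to be integral over `ℤ`
  obtain ⟨α, hα⟩ := Field.exists_primitive_element ℚ E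
  haveI : Algebra.IsAlgebraic ℤ ℚ := IsLocalization.isAlgebraic ℚ (nonZeroDivisors ℤ)
  have hαalg : IsAlgebraic ℤ α :=
    (Algebra.IsAlgebraic.isAlgebraic_iff (R := ℤ) (S := ℚ)).mpr (Algebra.IsAlgebraic.isAlgebraic α)
  obtain ⟨d, hd0, hθint⟩ := hαalg.exists_integral_multiple
  set θ : E := d • α with hθ
  have hθintQ : IsIntegral ℚ θ := hθint.tower_top
  -- `ℚ⟮θ⟯ = ⊤`
  have htop : IntermediateField.adjoin ℚ {θ} = ⊤ := by
    rw [eq_top_iff, ← hα, IntermediateField.adjoin_simple_le_iff]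
    have hθmem : θ ∈ IntermediateField.adjoin ℚ {θ} := IntermediateField.mem_adjoin_simple_self ℚ θ
    have : (d : ℚ)⁻¹ • θ = α := by
      rw [hθ, ← Int.cast_smul_eq_zsmul ℚ, smul_smul, inv_mul_cancel₀ (Int.cast_ne_zero.mpr hd0), one_smul]
    rw [← this]
    exact (IntermediateField.adjoin ℚ {θ}).smul_mem hθmem
  -- the power basis of `E` generated by `θ`
  let pb : PowerBasis ℚ E :=
    (IntermediateField.adjoin.powerBasis hθintQ).map
      ((IntermediateField.equivOfEq htop).trans IntermediateField.topEquiv)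
  have hpb_gen : pb.gen = θ := by
    simp [pb, IntermediateField.adjoin.powerBasis_gen]
  have hpb_dim : pb.dim = (minpoly ℚ θ).natDegree := by
    simp [pb, IntermediateField.adjoin.powerBasis_dim]
  have hn_pos : 0 < pb.dim := by rw [hpb_dim]; exact minpoly.natDegree_pos hθintQ
  -- the integer minimal polynomial `f = X^n + Σ b_j X^j`
  letI : IsIntegrallyClosed ℤ := GCDMonoid.toIsIntegrallyClosed
  set f : Polynomial ℤ := minpoly ℤ θ with hf
  have hf_monic : f.Monic := minpoly.monic hθint
  have hf_map : f.map (algebraMap ℤ ℚ) = minpoly ℚ θ :=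
    (minpoly.isIntegrallyClosed_eq_field_fractions' ℚ hθint).symm
  have hf_deg : f.natDegree = pb.dim := by
    rw [hpb_dim, ← hf_map, natDegree_map_eq_of_injective (algebraMap ℤ ℚ).injective_int]
  let b : Fin pb.dim → ℤ := fun j => f.coeff j
  -- the `n` embeddings `σ_s : E → ℂ` and the conjugates `ρ_s = σ_s θ`
  have hcard : Fintype.card (E →ₐ[ℚ] ℂ) = pb.dim := by
    rw [AlgHom.card ℚ E ℂ, pb.finrank]
  let σ : Fin pb.dim → (E →ₐ[ℚ] ℂ) := fun s => (Fintype.equivFinOfCardEq hcard).symm s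
  have hσ_bij : Function.Bijective σ := (Fintype.equivFinOfCardEq hcard).symm.bijective
  have hσ_inj : ∀ s, Function.Injective (σ s) := fun s => (σ s).toRingHom.injective
  let ρ : Fin pb.dim → ℂ := fun s => σ s θ
  have hρdef : ∀ s, ρ s = σ s θ := fun s => rfl
  -- `ρ` is injective: an embedding is determined by its value on the generator `θ`
  have hρ_inj : Function.Injective ρ := by
    intro s s' h
    apply hσ_bij.1
    apply pb.algHom_ext
    rw [hpb_gen]
    exact h
  -- `σ_s (μ_j)` is a root of `m`, i.e. some `μ_i`
  have hσβ : ∀ s j, ∃ i, σ s (β j) = μ i := by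
    intro s j
    rw [← hroot_iff, aeval_algHom_apply]
    have h0 : aeval (β j) m = 0 := by
      apply (algebraMap E ℂ).injective
      rw [← aeval_algebraMap_apply, map_zero]
      exact (hroot_iff (μ j)).mpr ⟨j, rfl⟩
    rw [h0, map_zero]
  -- all conjugates are non-real: otherwise `σ_s` would be real on `E = ℚ(θ) ∋ μ₀`
  have hρ_im : ∀ s, (ρ s).im ≠ 0 := by
    intro s him
    let τ : E →ₐ[ℚ] ℂ := ((Complex.conjAe.restrictScalars ℚ).toAlgHom).comp (σ s)
    have hτ : τ = σ s := by
      apply pb.algHom_ext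
      rw [hpb_gen]
      change (starRingEnd ℂ) (σ s θ) = σ s θ
      exact Complex.conj_eq_iff_im.mpr him
    obtain ⟨i, hi⟩ := hσβ s ⟨0, hN⟩
    apply hμim i
    rw [← hi, ← Complex.conj_eq_iff_im]
    change τ (β ⟨0, hN⟩) = σ s (β ⟨0, hN⟩)
    rw [hτ]
  -- `f(ρ_s) = 0`
  have hfρ : ∀ s, ρ s ^ pb.dim + ∑ j, (b j : ℂ) * ρ s ^ (j : ℕ) = 0 := by
    intro s
    have h1 : aeval (ρ s) (minpoly ℚ θ) = 0 := by
      rw [hρdef, aeval_algHom_apply, minpoly.aeval, map_zero]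
    have h2 : aeval (ρ s) (f.map (algebraMap ℤ ℚ)) = ρ s ^ pb.dim + ∑ j, (b j : ℂ) * ρ s ^ (j : ℕ) := by
      rw [aeval_map_algebraMap, aeval_eq_sum_range, hf_deg, Finset.sum_range_succ, Finset.sum_range]
      have hlead : f.coeff pb.dim = 1 := by rw [← hf_deg]; exact hf_monic
      rw [hlead, one_smul, add_comm]
      congr 1
      refine Finset.sum_congr rfl fun j _ => ?_
      rw [Algebra.smul_def, algebraMap_int_eq, eq_intCast]
    rw [← h2, hf_map, h1]
  -- power sums are integers (traces of the integral elements `θ^i`)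
  have hpow : ∀ i : ℕ, ∃ z : ℤ, ∑ s, ρ s ^ i = (z : ℂ) := by
    intro i
    have hint : IsIntegral ℤ (Algebra.trace ℚ E (θ ^ i)) := Algebra.isIntegral_trace (hθint.pow i)
    obtain ⟨z, hz⟩ := IsIntegrallyClosed.isIntegral_iff.mp hint
    refine ⟨z, ?_⟩
    have htr : algebraMap ℚ ℂ (Algebra.trace ℚ E (θ ^ i)) = ∑ τ : E →ₐ[ℚ] ℂ, τ (θ ^ i) :=
      trace_eq_sum_embeddings ℂ
    have hsum : ∑ s, ρ s ^ i = ∑ τ : E →ₐ[ℚ] ℂ, τ (θ ^ i) := by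
      rw [← (Equiv.ofBijective σ hσ_bij).sum_comp]
      simp only [Equiv.ofBijective_apply, map_pow, hρdef]
    rw [hsum, ← htr, ← hz]
    simp
  -- the permutations `e s`: `σ_s (μ_j) = μ_{e s j}`
  choose g hg using hσβ
  have hg_inj : ∀ s, Function.Injective (g s) := by
    intro s j j' h
    apply hβinj
    apply hσ_inj s
    rw [hg s j, hg s j', h]
  let e : Fin pb.dim → Equiv.Perm (Fin N) := fun s =>
    Equiv.ofBijective (g s) (Finite.injective_iff_bijective.mp (hg_inj s))
  have he : ∀ s j, σ s (β j) = μ (e s j) := fun s j => hg s j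
  -- Lagrange idempotents of the `β_j` and their coordinates in the power basis of `θ`
  have hβinjOn : Set.InjOn β (Finset.univ : Finset (Fin N)) := hβinj.injOn
  let L : Fin N → Polynomial E := fun j => Lagrange.basis Finset.univ β j
  have hLdeg : ∀ j, (L j).natDegree < N := by
    intro j
    show (Lagrange.basis Finset.univ β j).natDegree < N
    rw [Lagrange.natDegree_basis hβinjOn (Finset.mem_univ j), Finset.card_univ, Fintype.card_fin]
    omega
  have hLeval : ∀ j j', (L j).eval (β j') = if j = j' then 1 else 0 := by
    intro j j'
    show (Lagrange.basis Finset.univ β j).eval (β j') = _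
    split_ifs with h
    · subst h; exact Lagrange.eval_basis_self hβinjOn (Finset.mem_univ j)
    · exact Lagrange.eval_basis_of_ne h (Finset.mem_univ j')
  let c : Fin N → Fin N → Fin pb.dim → ℚ := fun j k l => pb.basis.repr ((L j).coeff k) l
  have hc : ∀ j k, ∑ l, algebraMap ℚ E (c j k l) * θ ^ (l : ℕ) = (L j).coeff k := by
    intro j k
    conv_rhs => rw [← pb.basis.sum_repr ((L j).coeff k)]
    refine Finset.sum_congr rfl fun l _ => ?_
    rw [pb.coe_basis, hpb_gen, Algebra.smul_def]
  -- the key identity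
  have hkey : ∀ s j l', ∑ k, ∑ l, (c j k l : ℂ) * μ l' ^ (k : ℕ) * ρ s ^ (l : ℕ) =
      if l' = e s j then 1 else 0 := by
    intro s j l'
    -- inner sum: `Σ_l c_{jkl} ρ_s^l = σ_s ((L j).coeff k)`
    have hinner : ∀ k : Fin N, ∑ l, (c j k l : ℂ) * μ l' ^ (k : ℕ) * ρ s ^ (l : ℕ) =
        σ s ((L j).coeff k) * μ l' ^ (k : ℕ) := by
      intro k
      rw [← hc j k, map_sum, Finset.sum_mul]
      refine Finset.sum_congr rfl fun l _ => ?_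
      rw [map_mul, map_pow, AlgHom.commutes, ← hρdef]
      simp only [eq_ratCast]
      ring
    simp_rw [hinner]
    -- `μ l' = σ_s (β j')` with `j' = (e s)⁻¹ l'`, and `Σ_k σ_s(coeff_k) (σ_s β_j')^k = σ_s (L j (β j'))`
    set j' := (e s).symm l' with hj'
    have hl' : μ l' = σ s (β j') := by rw [he, hj', Equiv.apply_symm_apply]
    have hev : (L j).eval (β j') = ∑ k : Fin N, (L j).coeff k * β j' ^ (k : ℕ) := by
      rw [eval_eq_sum_range' (hLdeg j), Fin.sum_univ_eq_sum_range (fun k => (L j).coeff k * β j' ^ k) N]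
    have hmap : σ s ((L j).eval (β j')) = ∑ k : Fin N, σ s ((L j).coeff k) * μ l' ^ (k : ℕ) := by
      rw [hev, map_sum]
      refine Finset.sum_congr rfl fun k _ => ?_
      rw [map_mul, map_pow, hl']
    rw [← hmap, hLeval]
    by_cases hjj : j = j'
    · have : l' = e s j := by rw [hjj, hj', Equiv.apply_symm_apply]
      rw [if_pos hjj, if_pos this, map_one]
    · have : l' ≠ e s j := by
        intro h
        apply hjj
        rw [hj', h, Equiv.symm_apply_apply]
      rw [if_neg hjj, if_neg this, map_zero]
  exact ⟨pb.dim, b, ρ, e, c, hn_pos, hρ_inj, hρ_im, hfρ, hpow, hkey⟩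

end Summit.HodgeConjecture.HodgeConjecture.Theorems.HodgeAbelianVarieties.CMPivotAndre

end
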